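import Mathlib.RingTheory.MvPolynomial.EulerIdentity
import Mathlib.RingTheory.MvPolynomial.Homogeneous
import Mathlib.Algebra.MvPolynomial.Equiv
import Mathlib.Algebra.MvPolynomial.Funext
import Mathlib.Algebra.Algebra.Bilinear
import Literature.RingTheory.MvPolynomial.WeightOperators
import HarnessLib

/-!
# The universal shift `y ↦ α + x` on `R[x ⊔ y]`: lowest homogeneous component, directional
# derivative, chain rule with the Euler operator, and generic specialisation

Generic `MvPolynomial` algebra (cell `val-lit`, row X2-DDS21 infrastructure for the frame
"R2 = genericity via the universal frame" of the `DDS2021_thm_3_2` programme; no named facts).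
Dutta–Dwivedi–Saxena [DuttaDwivediSaxena2022, §3] shift the variables by a random point,
`Φ : x_i ↦ z·x_i + α_i` ("`α_i` random elements of `F`, such that `T_{i,0}(α) ≠ 0`", full version
p0028 L751–754), and then repeatedly use that lowest `z`-order data at the shifted point behave
generically ("by similar argument as in Claim 3.4", p0031 L819–834; "the valuation with respect to `z`
and `ε` is non-negative", p0035 L935–936). The honest form of "for a random `α`" is a statement about
the UNIVERSAL shift, where the point is a second set of variables `y`: this file sets up that
two-sorted polynomial ring `MvPolynomial (σ ⊕ σ) R` (`inl` = the direction / grading variables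
`x`, `inr` = the position variables `y`) and proves the four facts the genericity step needs.

## Contents (definitions with bodies + proved API)

* `DirShift.xWeight σ : σ ⊕ σ → ℕ` — weight `1` on `x`, `0` on `y` (the `x`-grading);
  `DirShift.spec α` (`y ↦ α`), `DirShift.shift α` (`y ↦ α + x`) `: MvPolynomial (σ ⊕ σ) R →ₐ[R]
  MvPolynomial σ R`; `DirShift.shear` (`x ↦ x`, `y ↦ y + x`, an algebra endomorphism of
  `R[x ⊔ y]`) with `spec α ∘ shear = shift α`; `DirShift.dirDeriv = Σ_l x_l ∂/∂y_l` (`D_x`) and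
  `DirShift.eulerX = Σ_l x_l ∂/∂x_l` (`E_x`) as `R`-linear maps; values on generators, Leibniz
  rules, and compatibility of all of them with `MvPolynomial.map` (so that they commute with
  coefficientwise reduction, e.g. `ε ↦ 0`).
* WEIGHTS: `D_x` raises the `x`-weight by one (`IsWeightedHomogeneous.dirShift_dirDeriv`), `E_x`
  acts on `x`-weight-`d` polynomials as `d` (`eulerX_eq_nsmul`, from Mathlib's weighted Euler
  identity), `spec α` sends `x`-weight-`d` polynomials to forms of degree `d`.
* ★ LOWEST COMPONENT UNDER THE SHIFT (`homogeneousComponent_shift_eq_spec`,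
  `homogeneousComponent_shift_eq_zero`): for `P` of `x`-weight `d`,
  `[P(x, α + x)]_d = P(x, α)` and `[P(x, α + x)]_e = 0` for `e < d` — monomialwise
  `x^a (α + x)^b = α^b x^a + (degree > |a|)`; no factorials, any commutative semiring.
* ★ CHAIN RULE (`euler_shift`): `Σ_i x_i ∂_i (P(x, α + x)) = (E_x P + D_x P)(x, α + x)`; for `P` of
  `x`-weight `d` this is `d · P(x, α+x) + (D_x P)(x, α+x)` (`euler_shift_of_isWeightedHomogeneous`).
* ★ GENERIC SPECIALISATION (`spec_eq_map_eval`, `exists_avoid_of_ne_zero`): over an infinite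
  domain, a nonzero `P(x, y)` stays nonzero under `y ↦ α` for all `α` off the zero set of ONE
  nonzero polynomial `Δ(y)` (a nonzero `x`-coefficient of `P`).

Honest framing: folklore commutative algebra recorded for the DiDIL genericity step; nothing here
bears on VP versus VNP, which is NOT proved; `DDS2021_thm_3_2` remains a named fact.

## References

* [DuttaDwivediSaxena2022] P. Dutta, P. Dwivedi, N. Saxena, *Demystifying the border of depth-3
  algebraic circuits*, FOCS 2021; full version `paper:galaxy-pdf-7641649743695546420`: the map `Φ`
  and the random point `α` p0028 L751–757; Claim 3.4 proof p0029 L772–785; Claim 3.5 "similar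
  argument" p0031 L819–834; Claim 3.8 proof p0035–p0036 L934–943.
-/

open MvPolynomial

open scoped BigOperators

namespace Literature.RingTheory.MvPolynomial

namespace DirShift

section Defs

variable (σ : Type*) (R : Type*) [CommSemiring R]

/-- The `x`-grading of the universal frame `R[x ⊔ y]`: weight `1` on the direction variables
`x = inl`, weight `0` on the position variables `y = inr` ("with `z`-degree being kept track of",
the `z`-degree of `Φ(f)` being the `x`-degree after the shift).
[cite: DuttaDwivediSaxena2022, §3 the map Φ (full version p0028 L751–757)] -/
def xWeight : σ ⊕ σ → ℕ :=
  Sum.elim (fun _ => 1) (fun _ => 0)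

variable {σ}

/-- **Specialisation `y ↦ α`**: `P(x, y) ↦ P(x, α)`. [cite: DuttaDwivediSaxena2022, §3 "α_i are random elements of F" (full version p0028 L751–754)] -/
noncomputable def spec (α : σ → R) : MvPolynomial (σ ⊕ σ) R →ₐ[R] MvPolynomial σ R :=
  aeval (Sum.elim X fun l => C (α l))

/-- **The shift `y ↦ α + x`**: `P(x, y) ↦ P(x, α + x)` — DDS's `Φ : x ↦ z·x + α` read with the
`z`-degree as the `x`-grading. [cite: DuttaDwivediSaxena2022, §3 the map Φ (full version p0028 L751–757)] -/
noncomputable def shift (α : σ → R) : MvPolynomial (σ ⊕ σ) R →ₐ[R] MvPolynomial σ R :=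
  aeval (Sum.elim X fun l => C (α l) + X l)

variable (σ)

/-- **The shear `x ↦ x`, `y ↦ y + x`** of the universal frame (so that `shift α = spec α ∘ shear`).
[cite: DuttaDwivediSaxena2022, §3 the map Φ (full version p0028 L751–757)] -/
noncomputable def shear : MvPolynomial (σ ⊕ σ) R →ₐ[R] MvPolynomial (σ ⊕ σ) R :=
  aeval (Sum.elim (fun l => X (Sum.inl l)) fun l => X (Sum.inr l) + X (Sum.inl l))

variable [Fintype σ]

/-- **The directional derivative `D_x = Σ_l x_l ∂/∂y_l`** on `R[x ⊔ y]` (the derivative of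
`t ↦ P(x, y + t x)` at `t = 0`). [cite: DuttaDwivediSaxena2022, §3 DERIVE step (full version p0029 L766–770)] -/
noncomputable def dirDeriv : MvPolynomial (σ ⊕ σ) R →ₗ[R] MvPolynomial (σ ⊕ σ) R :=
  ∑ l : σ, LinearMap.mulLeft R (X (Sum.inl l) : MvPolynomial (σ ⊕ σ) R) ∘ₗ
    (pderiv (Sum.inr l)).toLinearMap

/-- **The Euler operator in the direction variables, `E_x = Σ_l x_l ∂/∂x_l`** on `R[x ⊔ y]`.
[cite: DuttaDwivediSaxena2022, §3 DERIVE step "z·∂_z" bookkeeping (full version p0029 L766–770)] -/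
noncomputable def eulerX : MvPolynomial (σ ⊕ σ) R →ₗ[R] MvPolynomial (σ ⊕ σ) R :=
  ∑ l : σ, LinearMap.mulLeft R (X (Sum.inl l) : MvPolynomial (σ ⊕ σ) R) ∘ₗ
    (pderiv (Sum.inl l)).toLinearMap

end Defs

/-! ### Values on generators, factorisation `shift = spec ∘ shear`, `map`-compatibility -/

section Generators

variable {σ : Type*} {R : Type*} [CommSemiring R]

/-- `x_l` has weight `1`. [cite: DuttaDwivediSaxena2022, §3 the map Φ (full version p0028 L751–757)] -/
@[simp] theorem xWeight_inl (l : σ) : xWeight σ (Sum.inl l) = 1 := rfl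

/-- `y_l` has weight `0`. [cite: DuttaDwivediSaxena2022, §3 the map Φ (full version p0028 L751–757)] -/
@[simp] theorem xWeight_inr (l : σ) : xWeight σ (Sum.inr l) = 0 := rfl

/-- `spec α (x_l) = x_l`. [cite: DuttaDwivediSaxena2022, §3 the map Φ (full version p0028 L751–757)] -/
@[simp] theorem spec_X_inl (α : σ → R) (l : σ) : spec R α (X (Sum.inl l)) = X l := by
  simp [spec]

/-- `spec α (y_l) = α_l`. [cite: DuttaDwivediSaxena2022, §3 the map Φ (full version p0028 L751–757)] -/
@[simp] theorem spec_X_inr (α : σ → R) (l : σ) : spec R α (X (Sum.inr l)) = C (α l) := by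
  simp [spec]

/-- `spec α` fixes constants. [cite: DuttaDwivediSaxena2022, §3 the map Φ (full version p0028 L751–757)] -/
@[simp] theorem spec_C (α : σ → R) (a : R) :
    spec R α (C a : MvPolynomial (σ ⊕ σ) R) = C a := by
  simp [spec]

/-- `shift α (x_l) = x_l`. [cite: DuttaDwivediSaxena2022, §3 the map Φ (full version p0028 L751–757)] -/
@[simp] theorem shift_X_inl (α : σ → R) (l : σ) : shift R α (X (Sum.inl l)) = X l := by
  simp [shift]

/-- `shift α (y_l) = α_l + x_l`. [cite: DuttaDwivediSaxena2022, §3 the map Φ (full version p0028 L751–757)] -/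
@[simp] theorem shift_X_inr (α : σ → R) (l : σ) : shift R α (X (Sum.inr l)) = C (α l) + X l := by
  simp [shift]

/-- `shift α` fixes constants. [cite: DuttaDwivediSaxena2022, §3 the map Φ (full version p0028 L751–757)] -/
@[simp] theorem shift_C (α : σ → R) (a : R) :
    shift R α (C a : MvPolynomial (σ ⊕ σ) R) = C a := by
  simp [shift]

/-- `shear (x_l) = x_l`. [cite: DuttaDwivediSaxena2022, §3 the map Φ (full version p0028 L751–757)] -/
@[simp] theorem shear_X_inl (l : σ) :
    shear σ R (X (Sum.inl l)) = X (Sum.inl l) := by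
  simp [shear]

/-- `shear (y_l) = y_l + x_l`. [cite: DuttaDwivediSaxena2022, §3 the map Φ (full version p0028 L751–757)] -/
@[simp] theorem shear_X_inr (l : σ) :
    shear σ R (X (Sum.inr l)) = X (Sum.inr l) + X (Sum.inl l) := by
  simp [shear]

/-- `shear` fixes constants. [cite: DuttaDwivediSaxena2022, §3 the map Φ (full version p0028 L751–757)] -/
@[simp] theorem shear_C (a : R) : shear σ R (C a) = C a := by
  simp [shear]

/-- **`shift α = spec α ∘ shear`**: shifting is shearing followed by specialising.
[cite: DuttaDwivediSaxena2022, §3 the map Φ (full version p0028 L751–757)] -/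
theorem spec_comp_shear (α : σ → R) : (spec R α).comp (shear σ R) = shift R α := by
  apply MvPolynomial.algHom_ext
  rintro (l | l) <;> simp

/-- `shift α P = spec α (shear P)`, pointwise. [cite: DuttaDwivediSaxena2022, §3 the map Φ (full version p0028 L751–757)] -/
theorem spec_shear (α : σ → R) (P : MvPolynomial (σ ⊕ σ) R) :
    spec R α (shear σ R P) = shift R α P := by
  rw [← spec_comp_shear, AlgHom.comp_apply]

/-- `spec` commutes with a change of coefficients (e.g. reduction modulo `ε`).
[cite: DuttaDwivediSaxena2022, §3 the map Φ (full version p0028 L751–757)] -/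
theorem map_spec {S : Type*} [CommSemiring S] (f : R →+* S) (α : σ → R)
    (P : MvPolynomial (σ ⊕ σ) R) :
    map f (spec R α P) = spec S (f ∘ α) (map f P) := by
  have h : (map f).comp (spec R α).toRingHom = (spec S (f ∘ α)).toRingHom.comp (map f) := by
    apply MvPolynomial.ringHom_ext
    · intro a
      simp
    · rintro (l | l) <;> simp
  exact RingHom.congr_fun h P

/-- `shift` commutes with a change of coefficients. [cite: DuttaDwivediSaxena2022, §3 the map Φ (full version p0028 L751–757)] -/
theorem map_shift {S : Type*} [CommSemiring S] (f : R →+* S) (α : σ → R)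
    (P : MvPolynomial (σ ⊕ σ) R) :
    map f (shift R α P) = shift S (f ∘ α) (map f P) := by
  have h : (map f).comp (shift R α).toRingHom = (shift S (f ∘ α)).toRingHom.comp (map f) := by
    apply MvPolynomial.ringHom_ext
    · intro a
      simp
    · rintro (l | l) <;> simp
  exact RingHom.congr_fun h P

/-- `shear` commutes with a change of coefficients. [cite: DuttaDwivediSaxena2022, §3 the map Φ (full version p0028 L751–757)] -/
theorem map_shear {S : Type*} [CommSemiring S] (f : R →+* S) (P : MvPolynomial (σ ⊕ σ) R) :
    map f (shear σ R P) = shear σ S (map f P) := by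
  have h : (map f).comp (shear σ R).toRingHom = (shear σ S).toRingHom.comp (map f) := by
    apply MvPolynomial.ringHom_ext
    · intro a
      simp
    · rintro (l | l) <;> simp
  exact RingHom.congr_fun h P

end Generators

/-! ### The directional derivative `D_x` and the Euler operator `E_x` -/

section Derivative

variable {σ : Type*} {R : Type*} [CommSemiring R] [Fintype σ]

/-- Unfolding `D_x`. [cite: DuttaDwivediSaxena2022, §3 DERIVE step (full version p0029 L766–770)] -/
theorem dirDeriv_apply (P : MvPolynomial (σ ⊕ σ) R) :
    dirDeriv σ R P = ∑ l : σ, X (Sum.inl l) * pderiv (Sum.inr l) P := by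
  simp [dirDeriv, LinearMap.sum_apply]

/-- Unfolding `E_x`. [cite: DuttaDwivediSaxena2022, §3 DERIVE step (full version p0029 L766–770)] -/
theorem eulerX_apply (P : MvPolynomial (σ ⊕ σ) R) :
    eulerX σ R P = ∑ l : σ, X (Sum.inl l) * pderiv (Sum.inl l) P := by
  simp [eulerX, LinearMap.sum_apply]

/-- `D_x` kills constants. [cite: DuttaDwivediSaxena2022, §3 DERIVE step (full version p0029 L766–770)] -/
@[simp] theorem dirDeriv_C (a : R) : dirDeriv σ R (C a) = 0 := by
  simp [dirDeriv_apply]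

/-- `E_x` kills constants. [cite: DuttaDwivediSaxena2022, §3 DERIVE step (full version p0029 L766–770)] -/
@[simp] theorem eulerX_C (a : R) : eulerX σ R (C a) = 0 := by
  simp [eulerX_apply]

/-- `D_x x_l = 0`. [cite: DuttaDwivediSaxena2022, §3 DERIVE step (full version p0029 L766–770)] -/
@[simp] theorem dirDeriv_X_inl (l : σ) :
    dirDeriv σ R (X (Sum.inl l)) = 0 := by
  classical
  rw [dirDeriv_apply]
  refine Finset.sum_eq_zero fun l' _ => ?_
  rw [pderiv_X_of_ne (Sum.inl_ne_inr), mul_zero]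

/-- `D_x y_l = x_l`. [cite: DuttaDwivediSaxena2022, §3 DERIVE step (full version p0029 L766–770)] -/
@[simp] theorem dirDeriv_X_inr (l : σ) :
    dirDeriv σ R (X (Sum.inr l)) = X (Sum.inl l) := by
  classical
  rw [dirDeriv_apply, Finset.sum_eq_single l]
  · rw [pderiv_X_self, mul_one]
  · intro l' _ hl'
    rw [pderiv_X_of_ne (fun h => hl' (Sum.inr_injective h).symm), mul_zero]
  · intro h
    exact absurd (Finset.mem_univ l) h

/-- `E_x x_l = x_l`. [cite: DuttaDwivediSaxena2022, §3 DERIVE step (full version p0029 L766–770)] -/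
@[simp] theorem eulerX_X_inl (l : σ) :
    eulerX σ R (X (Sum.inl l)) = X (Sum.inl l) := by
  classical
  rw [eulerX_apply, Finset.sum_eq_single l]
  · rw [pderiv_X_self, mul_one]
  · intro l' _ hl'
    rw [pderiv_X_of_ne (fun h => hl' (Sum.inl_injective h).symm), mul_zero]
  · intro h
    exact absurd (Finset.mem_univ l) h

/-- `E_x y_l = 0`. [cite: DuttaDwivediSaxena2022, §3 DERIVE step (full version p0029 L766–770)] -/
@[simp] theorem eulerX_X_inr (l : σ) :
    eulerX σ R (X (Sum.inr l)) = 0 := by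
  classical
  rw [eulerX_apply]
  refine Finset.sum_eq_zero fun l' _ => ?_
  rw [pderiv_X_of_ne (Sum.inr_ne_inl), mul_zero]

/-- **Leibniz rule for `D_x`.** [cite: DuttaDwivediSaxena2022, §3 DERIVE step (full version p0029 L766–770)] -/
theorem dirDeriv_mul (P Q : MvPolynomial (σ ⊕ σ) R) :
    dirDeriv σ R (P * Q) = dirDeriv σ R P * Q + P * dirDeriv σ R Q := by
  rw [dirDeriv_apply, dirDeriv_apply, dirDeriv_apply, Finset.sum_mul, Finset.mul_sum,
    ← Finset.sum_add_distrib]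
  refine Finset.sum_congr rfl fun l _ => ?_
  rw [Derivation.leibniz, smul_eq_mul, smul_eq_mul]
  ring

/-- **Leibniz rule for `E_x`.** [cite: DuttaDwivediSaxena2022, §3 DERIVE step (full version p0029 L766–770)] -/
theorem eulerX_mul (P Q : MvPolynomial (σ ⊕ σ) R) :
    eulerX σ R (P * Q) = eulerX σ R P * Q + P * eulerX σ R Q := by
  rw [eulerX_apply, eulerX_apply, eulerX_apply, Finset.sum_mul, Finset.mul_sum,
    ← Finset.sum_add_distrib]
  refine Finset.sum_congr rfl fun l _ => ?_
  rw [Derivation.leibniz, smul_eq_mul, smul_eq_mul]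
  ring

/-- `D_x` commutes with a change of coefficients. [cite: DuttaDwivediSaxena2022, §3 DERIVE step (full version p0029 L766–770)] -/
theorem map_dirDeriv {S : Type*} [CommSemiring S] (f : R →+* S) (P : MvPolynomial (σ ⊕ σ) R) :
    map f (dirDeriv σ R P) = dirDeriv σ S (map f P) := by
  rw [dirDeriv_apply, dirDeriv_apply, map_sum]
  refine Finset.sum_congr rfl fun l _ => ?_
  rw [map_mul, map_X, pderiv_map]

/-- `E_x` commutes with a change of coefficients. [cite: DuttaDwivediSaxena2022, §3 DERIVE step (full version p0029 L766–770)] -/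
theorem map_eulerX {S : Type*} [CommSemiring S] (f : R →+* S) (P : MvPolynomial (σ ⊕ σ) R) :
    map f (eulerX σ R P) = eulerX σ S (map f P) := by
  rw [eulerX_apply, eulerX_apply, map_sum]
  refine Finset.sum_congr rfl fun l _ => ?_
  rw [map_mul, map_X, pderiv_map]

end Derivative

/-! ### Bridge to the tree's weight operators -/

section WeightOp

variable {σ : Type*} {R : Type*} [CommRing R] [Fintype σ]

/-- **`E_x` is the tree's weight operator for the weight `xWeight`** (`WeightOperators.lean`:
`weightOp s = Σ_i s_i · X_i ∂_i`), so that `coeff_weightOp`, `weightOp_mul`, `weightDerivation`,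
`eq_C_of_euler_eq_zero` … apply to `eulerX` by name.
[cite: DuttaDwivediSaxena2022, §3 DERIVE step (full version p0029 L766–770)] -/
theorem eulerX_eq_weightOp (P : MvPolynomial (σ ⊕ σ) R) :
    eulerX σ R P = weightOp (fun i => (xWeight σ i : ℤ)) P := by
  rw [eulerX_apply, weightOp_apply, Fintype.sum_sum_type]
  simp

end WeightOp

/-! ### Weights -/

section Weights

variable {σ : Type*} {R : Type*} [CommSemiring R]

/-- `x_l` has `x`-weight `1`. [cite: DuttaDwivediSaxena2022, §3 the map Φ (full version p0028 L751–757)] -/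
theorem isWeightedHomogeneous_X_inl (l : σ) :
    IsWeightedHomogeneous (xWeight σ) (X (Sum.inl l) : MvPolynomial (σ ⊕ σ) R) 1 := by
  simpa using isWeightedHomogeneous_X R (xWeight σ) (Sum.inl l)

/-- `y_l` has `x`-weight `0`. [cite: DuttaDwivediSaxena2022, §3 the map Φ (full version p0028 L751–757)] -/
theorem isWeightedHomogeneous_X_inr (l : σ) :
    IsWeightedHomogeneous (xWeight σ) (X (Sum.inr l) : MvPolynomial (σ ⊕ σ) R) 0 := by
  simpa using isWeightedHomogeneous_X R (xWeight σ) (Sum.inr l)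

variable [Fintype σ]

/-- The `x`-weight of an exponent vector is the total degree of its `x`-part.
[cite: DuttaDwivediSaxena2022, §3 the map Φ (full version p0028 L751–757)] -/
theorem weight_xWeight (m : σ ⊕ σ →₀ ℕ) :
    Finsupp.weight (xWeight σ) m = ∑ l : σ, m (Sum.inl l) := by
  rw [Finsupp.weight_apply, Finsupp.sum_fintype _ _ (fun i => by simp)]
  rw [Fintype.sum_sum_type]
  simp

/-- **`D_x` raises the `x`-weight by one.** [cite: DuttaDwivediSaxena2022, §3 DERIVE step (full version p0029 L766–770)] -/
theorem _root_.MvPolynomial.IsWeightedHomogeneous.dirShift_dirDeriv {P : MvPolynomial (σ ⊕ σ) R}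
    {d : ℕ} (h : IsWeightedHomogeneous (xWeight σ) P d) :
    IsWeightedHomogeneous (xWeight σ) (dirDeriv σ R P) (d + 1) := by
  rw [dirDeriv_apply]
  refine IsWeightedHomogeneous.sum _ _ _ fun l _ => ?_
  rw [add_comm]
  exact (isWeightedHomogeneous_X_inl l).mul (h.pderiv (i := Sum.inr l) (by simp))

/-- **Euler's identity in the direction variables**: `E_x P = d · P` for `P` of `x`-weight `d`
(Mathlib's weighted Euler identity with the weight `xWeight`).
[cite: DuttaDwivediSaxena2022, §3 DERIVE step (full version p0029 L766–770)] -/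
theorem eulerX_eq_nsmul {P : MvPolynomial (σ ⊕ σ) R} {d : ℕ}
    (h : IsWeightedHomogeneous (xWeight σ) P d) : eulerX σ R P = d • P := by
  rw [eulerX_apply, ← h.sum_weight_X_mul_pderiv, Fintype.sum_sum_type]
  simp

/-- `E_x` preserves the `x`-weight. [cite: DuttaDwivediSaxena2022, §3 DERIVE step (full version p0029 L766–770)] -/
theorem _root_.MvPolynomial.IsWeightedHomogeneous.dirShift_eulerX {P : MvPolynomial (σ ⊕ σ) R}
    {d : ℕ} (h : IsWeightedHomogeneous (xWeight σ) P d) :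
    IsWeightedHomogeneous (xWeight σ) (eulerX σ R P) d := by
  rw [eulerX_eq_nsmul h]
  have hP : P ∈ weightedHomogeneousSubmodule R (xWeight σ) d :=
    (mem_weightedHomogeneousSubmodule R (xWeight σ) d P).mpr h
  exact (mem_weightedHomogeneousSubmodule R (xWeight σ) d _).mp (nsmul_mem hP d)

end Weights

/-! ### The lowest homogeneous component under the shift `y ↦ α + x` -/

section Lowest

variable {σ : Type*} {R : Type*} [CommSemiring R] [Fintype σ]

/-- The `x`-part of an exponent vector on `x ⊔ y`. [cite: DuttaDwivediSaxena2022, §3 the map Φ (full version p0028 L751–757)] -/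
noncomputable def xPart (m : σ ⊕ σ →₀ ℕ) : σ →₀ ℕ :=
  (Finsupp.sumFinsuppEquivProdFinsupp m).1

omit [Fintype σ] in
/-- Unfolding `xPart`. [cite: DuttaDwivediSaxena2022, §3 the map Φ (full version p0028 L751–757)] -/
@[simp] theorem xPart_apply (m : σ ⊕ σ →₀ ℕ) (l : σ) : xPart m l = m (Sum.inl l) :=
  Finsupp.fst_sumFinsuppEquivProdFinsupp m l

/-- The `x`-weight of an exponent is the degree of its `x`-part.
[cite: DuttaDwivediSaxena2022, §3 the map Φ (full version p0028 L751–757)] -/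
theorem weight_xWeight_eq_degree_xPart (m : σ ⊕ σ →₀ ℕ) :
    Finsupp.weight (xWeight σ) m = (xPart m).degree := by
  rw [weight_xWeight, Finsupp.degree_eq_sum]
  simp

/-- **The shift on a monomial**: `x^a y^b ↦ x^a · Π_l (α_l + x_l)^{b_l}`.
[cite: DuttaDwivediSaxena2022, §3 the map Φ (full version p0028 L751–757)] -/
theorem shift_monomial (α : σ → R) (m : σ ⊕ σ →₀ ℕ) (a : R) :
    shift R α (monomial m a) =
      monomial (xPart m) a * ∏ l : σ, (C (α l) + X l) ^ m (Sum.inr l) := by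
  rw [shift, aeval_monomial, Finsupp.prod_fintype _ _ (fun i => pow_zero _), Fintype.prod_sum_type]
  simp only [Sum.elim_inl, Sum.elim_inr]
  rw [algebraMap_eq, ← mul_assoc, monomial_eq, Finsupp.prod_fintype _ _ (fun i => pow_zero _)]
  simp only [xPart_apply]

/-- **The specialisation on a monomial**: `x^a y^b ↦ α^b x^a`.
[cite: DuttaDwivediSaxena2022, §3 "α_i are random elements of F" (full version p0028 L751–754)] -/
theorem spec_monomial (α : σ → R) (m : σ ⊕ σ →₀ ℕ) (a : R) :
    spec R α (monomial m a) = monomial (xPart m) (a * ∏ l : σ, α l ^ m (Sum.inr l)) := by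
  rw [spec, aeval_monomial, Finsupp.prod_fintype _ _ (fun i => pow_zero _), Fintype.prod_sum_type]
  simp only [Sum.elim_inl, Sum.elim_inr]
  rw [algebraMap_eq, monomial_eq, Finsupp.prod_fintype _ _ (fun i => pow_zero _), map_mul,
    map_prod]
  simp only [xPart_apply, map_pow]
  ring

/-- The constant term of `Π_l (α_l + x_l)^{b_l}` is `α^b`. [cite: DuttaDwivediSaxena2022, §3 the map Φ (full version p0028 L751–757)] -/
theorem constantCoeff_prod_C_add_X_pow (α : σ → R) (b : σ → ℕ) :
    constantCoeff (∏ l : σ, (C (α l) + X l : MvPolynomial σ R) ^ b l) = ∏ l : σ, α l ^ b l := by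
  rw [map_prod]
  simp

omit [Fintype σ] in
/-- Exponents above `s` of the same degree as `s` equal `s`. [cite: DuttaDwivediSaxena2022, §3 the map Φ (full version p0028 L751–757)] -/
theorem eq_of_le_of_degree_eq {s n : σ →₀ ℕ} (h : s ≤ n) (hd : n.degree = s.degree) : s = n := by
  obtain ⟨k, rfl⟩ := exists_add_of_le h
  rw [map_add] at hd
  have hk : k.degree = 0 := by omega
  rw [(Finsupp.degree_eq_zero_iff k).mp hk, add_zero]

omit [Fintype σ] in
/-- **Degree-`|a|` component of `x^a · G` is `x^a · G(0)`.** [cite: DuttaDwivediSaxena2022, Claim 3.4 proof (full version p0029 L772–779)] -/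
theorem homogeneousComponent_monomial_mul_self (s : σ →₀ ℕ) (a : R) (G : MvPolynomial σ R) :
    homogeneousComponent s.degree (monomial s a * G) = monomial s (a * constantCoeff G) := by
  classical
  ext n
  rw [coeff_homogeneousComponent, coeff_monomial_mul', coeff_monomial]
  by_cases hn : s = n
  · subst hn
    simp only [le_refl, if_true, tsub_self]
    rfl
  · rw [if_neg hn]
    split_ifs with h1 h2
    · exact absurd (eq_of_le_of_degree_eq h2 h1) hn
    · rfl
    · rfl

omit [Fintype σ] in
/-- **Components of `x^a · G` below degree `|a|` vanish.** [cite: DuttaDwivediSaxena2022, Claim 3.4 proof (full version p0029 L772–779)] -/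
theorem homogeneousComponent_monomial_mul_eq_zero (s : σ →₀ ℕ) (a : R) (G : MvPolynomial σ R)
    {e : ℕ} (he : e < s.degree) : homogeneousComponent e (monomial s a * G) = 0 := by
  classical
  ext n
  rw [coeff_homogeneousComponent, coeff_monomial_mul', coeff_zero]
  split_ifs with h1 h2
  · exfalso
    have hle : s.degree ≤ n.degree := Finsupp.degree_mono h2
    rw [h1] at hle
    exact absurd he (not_lt.mpr hle)
  · rfl
  · rfl

/-- ★ **Lowest component under the shift, monomial case**: the degree-`|a|` component of
`x^a (α + x)^b` is `α^b x^a`. [cite: DuttaDwivediSaxena2022, Claim 3.4 proof (full version p0029 L772–779)] -/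
theorem homogeneousComponent_shift_monomial (α : σ → R) (m : σ ⊕ σ →₀ ℕ) (a : R) :
    homogeneousComponent (xPart m).degree (shift R α (monomial m a)) = spec R α (monomial m a) := by
  rw [shift_monomial, homogeneousComponent_monomial_mul_self, constantCoeff_prod_C_add_X_pow,
    spec_monomial]

/-- Lower components of a shifted monomial vanish. [cite: DuttaDwivediSaxena2022, Claim 3.4 proof (full version p0029 L772–779)] -/
theorem homogeneousComponent_shift_monomial_eq_zero (α : σ → R) (m : σ ⊕ σ →₀ ℕ) (a : R) {e : ℕ}
    (he : e < (xPart m).degree) : homogeneousComponent e (shift R α (monomial m a)) = 0 := by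
  rw [shift_monomial, homogeneousComponent_monomial_mul_eq_zero _ _ _ he]

/-- ★ **LOWEST COMPONENT UNDER THE SHIFT**: for `P(x, y)` of `x`-weight `d`, the degree-`d`
homogeneous component of `P(x, α + x)` is `P(x, α)` — "`Φ(T)|_{z=0} = T(α)`" and, one order up,
the statement that the `z`-INITIAL form of a shifted object is the specialised universal object
(what "by similar argument as in Claim 3.4" uses at every later stage).
[cite: DuttaDwivediSaxena2022, §3 the map Φ "Φ(T_{i,0})|_{x=0} = T_{i,0}(α)" (full version p0028 L753–754); Claim 3.5 (p0031 L819–834)] -/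
theorem homogeneousComponent_shift_eq_spec (α : σ → R) {P : MvPolynomial (σ ⊕ σ) R} {d : ℕ}
    (h : IsWeightedHomogeneous (xWeight σ) P d) :
    homogeneousComponent d (shift R α P) = spec R α P := by
  classical
  conv_lhs => rw [P.as_sum]
  conv_rhs => rw [P.as_sum]
  rw [map_sum (shift R α), map_sum (homogeneousComponent d), map_sum (spec R α)]
  refine Finset.sum_congr rfl fun m hm => ?_
  have hd : (xPart m).degree = d := by
    rw [← weight_xWeight_eq_degree_xPart]
    exact h (mem_support_iff.mp hm)
  rw [← hd, homogeneousComponent_shift_monomial]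

/-- ★ **No components below the `x`-weight**: for `P` of `x`-weight `d` and `e < d`, the degree-`e`
component of `P(x, α + x)` vanishes (`val_z Φ(T) ≥` the `z`-order datum).
[cite: DuttaDwivediSaxena2022, Claim 3.4 proof "val_z(…) ≥ v_{k,0}" (full version p0029 L772–776)] -/
theorem homogeneousComponent_shift_eq_zero (α : σ → R) {P : MvPolynomial (σ ⊕ σ) R} {d e : ℕ}
    (h : IsWeightedHomogeneous (xWeight σ) P d) (he : e < d) :
    homogeneousComponent e (shift R α P) = 0 := by
  classical
  conv_lhs => rw [P.as_sum]
  rw [map_sum (shift R α), map_sum (homogeneousComponent e)]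
  refine Finset.sum_eq_zero fun m hm => ?_
  have hd : (xPart m).degree = d := by
    rw [← weight_xWeight_eq_degree_xPart]
    exact h (mem_support_iff.mp hm)
  exact homogeneousComponent_shift_monomial_eq_zero α m _ (hd ▸ he)

/-- The specialisation of an `x`-weight-`d` polynomial is a form of degree `d`.
[cite: DuttaDwivediSaxena2022, §3 the map Φ (full version p0028 L751–757)] -/
theorem isHomogeneous_spec (α : σ → R) {P : MvPolynomial (σ ⊕ σ) R} {d : ℕ}
    (h : IsWeightedHomogeneous (xWeight σ) P d) : (spec R α P).IsHomogeneous d := by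
  rw [← homogeneousComponent_shift_eq_spec α h]
  exact homogeneousComponent_isHomogeneous d _

end Lowest

/-! ### The chain rule: Euler operator of a shifted polynomial -/

section ChainRule

variable {σ : Type*} {R : Type*} [CommSemiring R] [Fintype σ]

/-- Leibniz rule for the (unfolded) Euler operator `Σ_i x_i ∂_i` on `R[x]`.
[cite: DuttaDwivediSaxena2022, §3 DERIVE step (full version p0029 L766–770)] -/
theorem sum_X_mul_pderiv_mul (p q : MvPolynomial σ R) :
    ∑ i : σ, X i * pderiv i (p * q) =
      (∑ i : σ, X i * pderiv i p) * q + p * ∑ i : σ, X i * pderiv i q := by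
  rw [Finset.sum_mul, Finset.mul_sum, ← Finset.sum_add_distrib]
  refine Finset.sum_congr rfl fun i _ => ?_
  rw [Derivation.leibniz, smul_eq_mul, smul_eq_mul]
  ring

/-- `Σ_i x_i ∂_i` kills constants. [cite: DuttaDwivediSaxena2022, §3 DERIVE step (full version p0029 L766–770)] -/
theorem sum_X_mul_pderiv_C (a : R) : ∑ i : σ, X i * pderiv i (C a : MvPolynomial σ R) = 0 := by
  simp

/-- `Σ_i x_i ∂_i x_l = x_l`. [cite: DuttaDwivediSaxena2022, §3 DERIVE step (full version p0029 L766–770)] -/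
theorem sum_X_mul_pderiv_X (l : σ) : ∑ i : σ, X i * pderiv i (X l : MvPolynomial σ R) = X l := by
  classical
  rw [Finset.sum_eq_single l]
  · rw [pderiv_X_self, mul_one]
  · intro i _ hi
    rw [pderiv_X_of_ne (Ne.symm hi), mul_zero]
  · intro h
    exact absurd (Finset.mem_univ l) h

/-- The chain rule on generators. [cite: DuttaDwivediSaxena2022, §3 DERIVE step (full version p0029 L766–770)] -/
theorem euler_shift_X (α : σ → R) (s : σ ⊕ σ) :
    ∑ i : σ, X i * pderiv i (shift R α (X s)) =
      shift R α (eulerX σ R (X s) + dirDeriv σ R (X s)) := by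
  rcases s with l | l
  · rw [shift_X_inl, sum_X_mul_pderiv_X, eulerX_X_inl, dirDeriv_X_inl, add_zero, shift_X_inl]
  · rw [shift_X_inr, eulerX_X_inr, dirDeriv_X_inr, zero_add, shift_X_inl]
    have h : ∀ i : σ, X i * pderiv i (C (α l) + X l : MvPolynomial σ R) = X i * pderiv i (X l) :=
      fun i => by rw [map_add, pderiv_C, zero_add]
    simp only [h]
    exact sum_X_mul_pderiv_X l

/-- ★ **CHAIN RULE**: `Σ_i x_i ∂_i (P(x, α + x)) = (E_x P + D_x P)(x, α + x)` — the Euler operator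
of the shifted polynomial is the shift of "Euler in `x` plus the directional derivative in `y`"
(`∂/∂x_l [P(x, α+x)] = (∂_{x_l} P + ∂_{y_l} P)(x, α+x)`).
[cite: DuttaDwivediSaxena2022, §3 DERIVE step and Claim 3.5 "similar argument" (full version p0029 L766–770, p0031 L819–834)] -/
theorem euler_shift (α : σ → R) (P : MvPolynomial (σ ⊕ σ) R) :
    ∑ i : σ, X i * pderiv i (shift R α P) = shift R α (eulerX σ R P + dirDeriv σ R P) := by
  classical
  induction P using MvPolynomial.induction_on with
  | C a =>
    rw [shift_C, sum_X_mul_pderiv_C, eulerX_C, dirDeriv_C, add_zero, map_zero]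
  | add p q hp hq =>
    calc ∑ i : σ, X i * pderiv i (shift R α (p + q))
        = ∑ i : σ, (X i * pderiv i (shift R α p) + X i * pderiv i (shift R α q)) := by
          refine Finset.sum_congr rfl fun i _ => ?_
          simp only [map_add, mul_add]
      _ = shift R α (eulerX σ R p + dirDeriv σ R p) + shift R α (eulerX σ R q + dirDeriv σ R q) := by
          simp only [Finset.sum_add_distrib, hp, hq]
      _ = shift R α (eulerX σ R (p + q) + dirDeriv σ R (p + q)) := by
          simp only [map_add]
          abel
  | mul_X p s hp =>
    calc ∑ i : σ, X i * pderiv i (shift R α (p * X s))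
        = ∑ i : σ, X i * pderiv i (shift R α p * shift R α (X s)) := by
          simp only [map_mul]
      _ = (∑ i : σ, X i * pderiv i (shift R α p)) * shift R α (X s) +
            shift R α p * ∑ i : σ, X i * pderiv i (shift R α (X s)) := sum_X_mul_pderiv_mul _ _
      _ = shift R α (eulerX σ R p + dirDeriv σ R p) * shift R α (X s) +
            shift R α p * shift R α (eulerX σ R (X s) + dirDeriv σ R (X s)) := by
          simp only [hp, euler_shift_X]
      _ = shift R α ((eulerX σ R p + dirDeriv σ R p) * X s +
            p * (eulerX σ R (X s) + dirDeriv σ R (X s))) := by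
          simp only [map_mul, map_add]
      _ = shift R α (eulerX σ R (p * X s) + dirDeriv σ R (p * X s)) := by
          congr 1
          simp only [eulerX_mul, dirDeriv_mul]
          ring

/-- The chain rule for `P` of `x`-weight `d`: `Σ_i x_i ∂_i (P(x, α+x)) = d·P(x, α+x) + (D_x P)(x, α+x)`.
[cite: DuttaDwivediSaxena2022, §3 DERIVE step and Claim 3.5 (full version p0029 L766–770, p0031 L819–834)] -/
theorem euler_shift_of_isWeightedHomogeneous (α : σ → R) {P : MvPolynomial (σ ⊕ σ) R} {d : ℕ}
    (h : IsWeightedHomogeneous (xWeight σ) P d) :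
    ∑ i : σ, X i * pderiv i (shift R α P) = d • shift R α P + shift R α (dirDeriv σ R P) := by
  rw [euler_shift, eulerX_eq_nsmul h, map_add, map_nsmul]

end ChainRule

/-! ### Generic specialisation -/

section Generic

variable {σ : Type*} {R : Type*} [CommSemiring R]

/-- **`spec α` is coefficientwise evaluation**: moving the `y`-variables into the coefficients
(`sumAlgEquiv`), `P(x, α)` is `P` with every `y`-coefficient evaluated at `α`.
[cite: DuttaDwivediSaxena2022, §3 "α_i are random elements of F" (full version p0028 L751–754)] -/
theorem spec_eq_map_eval (α : σ → R) (P : MvPolynomial (σ ⊕ σ) R) :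
    spec R α P = map (eval α) (sumAlgEquiv R σ σ P) := by
  induction P using MvPolynomial.induction_on with
  | C a =>
    rw [spec_C, sumAlgEquiv_C_inl, map_C, eval_C]
  | add p q hp hq =>
    rw [map_add, map_add, map_add, hp, hq]
  | mul_X p s hp =>
    rw [map_mul, map_mul, map_mul, hp]
    congr 1
    rcases s with l | l
    · rw [spec_X_inl, sumAlgEquiv_X_inl, map_X]
    · rw [spec_X_inr, sumAlgEquiv_X_inr, map_C, eval_X]

/-- ★ **Nonvanishing under specialisation is a polynomial condition on the point**: for
`P(x, y) ≠ 0` there is a nonzero `Δ(y)` (a nonzero `x`-coefficient of `P`) such that `P(x, α) ≠ 0`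
whenever `Δ(α) ≠ 0`. [cite: DuttaDwivediSaxena2022, §3 "α_i are random elements of F, such that T_{i,0}(α) ≠ 0" (full version p0028 L751–754)] -/
theorem exists_avoid_of_ne_zero {P : MvPolynomial (σ ⊕ σ) R} (hP : P ≠ 0) :
    ∃ Δ : MvPolynomial σ R, Δ ≠ 0 ∧ ∀ α : σ → R, eval α Δ ≠ 0 → spec R α P ≠ 0 := by
  have hQ : sumAlgEquiv R σ σ P ≠ 0 := fun h =>
    hP ((sumAlgEquiv R σ σ).injective (by rw [h, map_zero]))
  obtain ⟨A, hA⟩ := MvPolynomial.ne_zero_iff.mp hQ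
  refine ⟨coeff A (sumAlgEquiv R σ σ P), hA, fun α hα h0 => hα ?_⟩
  have h1 := congrArg (coeff A) (spec_eq_map_eval α P)
  rw [h0, coeff_zero, coeff_map] at h1
  exact h1.symm

variable {S : Type*} [CommRing S] [IsDomain S] [Infinite S]

/-- Over an infinite domain a nonzero polynomial has a non-root.
[cite: DuttaDwivediSaxena2022, §3 "α_i are random elements of F" (full version p0028 L751–754)] -/
theorem exists_eval_ne_zero {Δ : MvPolynomial σ S} (hΔ : Δ ≠ 0) : ∃ α : σ → S, eval α Δ ≠ 0 := by
  by_contra h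
  simp only [not_exists, not_not] at h
  exact hΔ (MvPolynomial.funext fun α => by rw [h α, map_zero])

/-- ★ **Generic points exist for finitely many conditions**: over an infinite domain, finitely many
nonzero `P_i(x, y)` stay simultaneously nonzero under `y ↦ α` for some point `α`.
[cite: DuttaDwivediSaxena2022, §3 "α_i are random elements of F, such that T_{i,0}(α) ≠ 0, for all i ∈ [k]" (full version p0028 L751–754)] -/
theorem exists_spec_ne_zero {ι : Type*} (t : Finset ι) (P : ι → MvPolynomial (σ ⊕ σ) S)
    (hP : ∀ i ∈ t, P i ≠ 0) : ∃ α : σ → S, ∀ i ∈ t, spec S α (P i) ≠ 0 := by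
  classical
  choose! Δ hΔ hΔP using fun i (hi : i ∈ t) => exists_avoid_of_ne_zero (hP i hi)
  have hprod : ∏ i ∈ t, Δ i ≠ 0 := Finset.prod_ne_zero_iff.mpr fun i hi => hΔ i hi
  obtain ⟨α, hα⟩ := exists_eval_ne_zero hprod
  rw [map_prod] at hα
  exact ⟨α, fun i hi => hΔP i hi α (Finset.prod_ne_zero_iff.mp hα i hi)⟩

end Generic

end DirShift

end Literature.RingTheory.MvPolynomial
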